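import Literature.AlgebraicGeometry.ComplexMultiplication.EndomorphismFieldInducedTypeHodge
import Literature.AlgebraicGeometry.HodgeTheory.WeilTypeIsogenyClassSquares
import HarnessLib

/-!
# A pair `(A, ι : F ↪ End_ℚ(A))` whose type is induced from an imaginary quadratic subfield is of Weil type
# iff `dim A` is even — and then for every `K = ℚ(√-D)`

Topic `Literature/AlgebraicGeometry/ComplexMultiplication` (family `hodge`, lane `lit-hodgefound`), theorem-only sequel of
`EndomorphismFieldInducedTypeHodge` (Shimura §6.2 THEOREM 3 on the algebraic carrier: for a complex abelian variety `A` with a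
field `ι : F → End_ℚ(A)` of degree `[F : ℚ] = 2 dim A` whose type `cmTypeOfPair ι hF` is induced from a CM type of an
IMAGINARY QUADRATIC subfield `K₀ ≤ F`, `A ∼ E^{dim A}` for a CM elliptic curve `E`, `exists_ellipticCurve_isIsogenous_powSucc`)
and of `HodgeTheory/WeilTypeIsogenyClassSquares` §5 (every even power `X^{2k}` is of Weil type for every `D`, Deligne's `A₀ ⊗_ℚ E`; an
abelian variety of Weil type has even dimension). The opposite extreme of `EndomorphismFieldSimplePairWeilType` (SIMPLE pairs:
Weil type iff THE type is degenerate). No definition, no named fact, sorry-free.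

## The printed statements

* G. Shimura, *Abelian Varieties with Complex Multiplication and Modular Functions* (1998) [Shimura1998], §6.2 Thm. 3 and its
  proof (pp. 42–44): for `(F; {φᵢ})` induced from `(K; {ψⱼ})`, «`ℂⁿ/D(𝔪)` is complex analytically isomorphic to the direct
  product of `h` copies of `ℂ^m/Δ`», `h = [F : K]`; with `K` imaginary quadratic, `m = 1`: `A ∼ E^{dim A}`.
* P. Deligne (notes by J. Milne), LNM 900 (1982) [Deligne1982HodgeCycles], §4, proof of Thm. 4.8 (a)–(b): `A₀ ⊗_ℚ E`
  («`A₀` any abelian variety of dimension `d/2`», `e ∈ E` acting «through its action on `E`») satisfies (4.4).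
* B. van Geemen, LNM 1594 (1994) [vanGeemen1994HodgeAV], 4.9: `dim X = 2n`; proof of Lemma 5.2 (3): Weil type passes along
  isogenies.
* B. Moonen, Yu. Zarhin, Math. Ann. 315 (1999) [MoonenZarhin1999LowDim], (1.9): the multiplicities `(a, b)` of `K` on `T_{X,0}`.

## What is proved

* **`weilType_iff_even_dim_of_inducedCMType`** — under Shimura's hypotheses with `[K₀ : ℚ] = 2`:
  `HodgeTheory.WeilType A ↔ Even (dim A)` (`A ∼ E^{dim A}`; `E^{m+1}` is of Weil type iff `m + 1` is even).
* **`exists_isWeilType_of_inducedCMType`** — if moreover `dim A = 2k`, then for EVERY `D ≥ 1` there are `ψ ∈ End(A)` and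
  `N ≥ 1` with `(A, ψ)` of Weil type `(k, N² D)`: `A` is of Weil type for every imaginary quadratic field `ℚ(√-D) = ℚ(√-N²D)`
  (the structure `J_D` of `E^{2k} = (E^k)²` transported along the isogeny `E^{2k} → A`, `IsWeilType.exists_of_isIsogeny`).
* `not_weilType_of_inducedCMType_of_odd` — if `dim A` is odd, `A` is not of Weil type.
-/

noncomputable section

namespace Literature.AlgebraicGeometry.ComplexMultiplication

open CategoryTheory NumberField Module
open Literature.AlgebraicGeometry.Motives Literature.AlgebraicGeometry.HodgeTheory
open Literature.NumberTheory.ComplexMultiplication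

namespace EndFieldFullDegree

variable {F : Type} [Field F] [NumberField F] {A : AbelianVariety ℂ}
  (ιF : F →+* A.endAlgebra) (hF : finrank ℚ F = 2 * A.dim)
  {K₀ : IntermediateField ℚ F} {Φ₀ : CMType K₀}
  (hK₀ : finrank ℚ K₀ = 2) (hΦ : inducedCMType (algebraMap K₀ F) Φ₀ = cmTypeOfPair ιF hF)

include hF in
/-- `dim A ≥ 1` for a pair `(A, ι)` with `[F : ℚ] = 2 dim A`. [folklore] -/
private theorem dim_pos_of_pair : 0 < A.dim := by
  have h : 0 < finrank ℚ F := finrank_pos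
  omega

include hK₀ hΦ in
/-- **A PAIR `(A, ι)` WITH TYPE INDUCED FROM AN IMAGINARY QUADRATIC SUBFIELD IS OF WEIL TYPE IFF `dim A` IS EVEN.**
(`A ∼ E^{dim A}` for a CM elliptic curve `E`, Shimura §6.2 Thm. 3; an abelian variety of Weil type has dimension `2n`; every
even power `E^{2k}` is of Weil type — Deligne's `E^k ⊗_ℚ ℚ(√-D)` — and Weil type passes along isogenies.)
[cite: Shimura1998, §6.2 Thm. 3 (proof), pp. 42–44] [cite: Deligne1982HodgeCycles, §4, proof of Thm. 4.8 (a)–(b)]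
[cite: vanGeemen1994HodgeAV, 4.9 and proof of Lemma 5.2 (3)] -/
theorem weilType_iff_even_dim_of_inducedCMType : HodgeTheory.WeilType A ↔ Even A.dim := by
  obtain ⟨E, hE1, -, -, hEA⟩ := exists_ellipticCurve_isIsogenous_powSucc ιF hF hK₀ hΦ
  have hpos : 0 < A.dim := dim_pos_of_pair hF
  refine ⟨HodgeTheory.WeilType.even_dim, fun ⟨k, hk⟩ => ?_⟩
  have hk1 : A.dim - 1 = 2 * (k - 1) + 1 := by omega
  rw [hk1] at hEA
  exact HodgeTheory.WeilType.of_isIsogenous_powSucc_two_mul_add_one (X := E) (by omega) (k - 1) hEA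

include hK₀ hΦ in
/-- … in particular such an `A` of ODD dimension (e.g. `A ∼ E³`) is not of Weil type. [cite: vanGeemen1994HodgeAV, 4.9]
[cite: Shimura1998, §6.2 Thm. 3 (proof), pp. 42–44] -/
theorem not_weilType_of_inducedCMType_of_odd (hodd : Odd A.dim) : ¬ HodgeTheory.WeilType A := fun h =>
  (Nat.not_even_iff_odd.2 hodd) ((weilType_iff_even_dim_of_inducedCMType ιF hF hK₀ hΦ).1 h)

include hK₀ hΦ in
/-- **… AND THEN OF WEIL TYPE FOR EVERY IMAGINARY QUADRATIC FIELD**: if `dim A = 2k`, then for every `D ≥ 1` there are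
`ψ ∈ End(A)` and `N ≥ 1` with `(A, ψ)` of Weil type `(k, N² D)` (`ℚ(ψ) ≅ ℚ(√-N²D) = ℚ(√-D)`): the structure `J_D` of
`E^{2k} = (E^k)²` carried along the isogeny `E^{2k} → A` by the quasi-inverse. [cite: Deligne1982HodgeCycles, §4, proof of Thm. 4.8 (a)–(b)]
[cite: Shimura1998, §6.2 Thm. 3 (proof), pp. 42–44] [cite: vanGeemen1994HodgeAV, proof of Lemma 5.2 (3)]
[cite: MoonenZarhin1999LowDim, (1.9)] -/
theorem exists_isWeilType_of_inducedCMType {k D : ℕ} (hk : A.dim = 2 * k) (hD : 0 < D) :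
    ∃ (ψ : A ⟶ A) (N : ℕ), 0 < N ∧ HodgeTheory.IsWeilType A ψ k (N ^ 2 * D) := by
  obtain ⟨E, hE1, -, -, hEA⟩ := exists_ellipticCurve_isIsogenous_powSucc ιF hF hK₀ hΦ
  have hpos : 0 < A.dim := dim_pos_of_pair hF
  have hk1 : A.dim - 1 = 2 * (k - 1) + 1 := by omega
  rw [hk1] at hEA
  obtain ⟨g, hg⟩ := hEA
  obtain ⟨φ, hφ⟩ := HodgeTheory.exists_isWeilType_powSucc_two_mul_add_one (X := E) (by omega) hD (k - 1)
  rw [hE1, mul_one, show k - 1 + 1 = k by omega] at hφ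
  obtain ⟨ψ, N, hN, -, hψ⟩ := hφ.exists_of_isIsogeny hg
  exact ⟨ψ, N, hN, hψ⟩

end EndFieldFullDegree

end Literature.AlgebraicGeometry.ComplexMultiplication

end
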